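import Literature.NumberTheory.LFunctions.KloostermanIncompleteInterval
import Literature.NumberTheory.LFunctions.KloostermanFractionsOffDiagSet
import HarnessLib

/-!
# Trilinear forms with Kloosterman fractions: incomplete Kloosterman sums with the twist `e(θ/m)` (Remark 2)

Topic `NumberTheory/LFunctions`.  S. Bettin, V. Chandee, *Trilinear forms with Kloosterman
fractions*, Adv. Math. 328 (2018), Remark 2 (p. 13 of arXiv:1502.00769): "All the computations
of Section 3 and 4 work, applying partial summation at appropriate places, also when an extra
addend `f_{a,ϑ}(m,bn)` … is inserted in the exponential" — for the twist `f(x,y) = ϑa/(xy)` used in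
§7 the `m`-sums of §3 (the diagonal terms, bounded by "the version of Weil's bound given in
Lemma 1") acquire a factor `e(θ/m)`.  This file PROVES the corresponding twisted form of the
appendix Lemma 1 (case `(k,γ) = 1`, `δ = 1`, the tree's `KI_sum_progression_le` with `q = 1`):

* **`BC_twisted_incomplete_kloosterman_le`** — for `s ≥ 1`, integers `a`, `0 ≤ M₁ ≤ M₂` and real
  `θ`,
  `‖∑_{M₁ < m ≤ M₂, (m,s)=1} e(a m̄/s) e(θ/m)‖ ≤ (((M₂−M₁)/s)(a,s) + τ(s) s^{1/2} (a,s)^{1/2} (1 + log s)) (1 + 2π|θ|/(M₁+1))`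
  (Abel summation `kfw_abel_bound` against the twist, whose variation is `kfw_twist_variation`).

It is the first ingredient of §3 (3.5) for the general-`A`, twisted moments (the hypothesis `hD` of
`BC_CbA_bound_of_diagA_offA`, `TrilinearKloostermanFractionsFrom51.lean`).  No new named facts
(D-0026).

## References

* S. Bettin, V. Chandee, Adv. Math. 328 (2018) 1234–1262 (arXiv:1502.00769), Remark 2 and
  Appendix, Lemma 1. [BettinChandee2018]
* W. Duke, J. Friedlander, H. Iwaniec, Invent. Math. 128 (1997) 23–43, Lemma 8.
  [DukeFriedlanderIwaniec1997]
-/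

noncomputable section

open Finset Real

namespace Literature.NumberTheory.LFunctions

/-- **Incomplete Kloosterman sums with the twist `e(θ/m)`** (Bettin–Chandee, Appendix Lemma 1 +
Remark 2's partial summation): for `s ≥ 1`, `a ∈ ℤ`, integers `0 ≤ M₁ ≤ M₂` and real `θ`,
`‖∑_{M₁<m≤M₂,(m,s)=1} e(a m̄/s + θ/m)‖ ≤ (((M₂-M₁)/s)(a,s) + τ(s)√s√(a,s)(1+log s)) (1 + 2π|θ|/(M₁+1))`.
[cite: BettinChandee2018, Appendix Lemma 1 and Remark 2] -/
theorem BC_twisted_incomplete_kloosterman_le {s : ℕ} (hs : 0 < s) (a : ℤ) (θ : ℝ) {M₁ M₂ : ℤ}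
    (hM₁ : 0 ≤ M₁) (hM : M₁ ≤ M₂) :
    ‖∑ m ∈ (Finset.Ioc M₁ M₂).filter (fun m : ℤ => Int.gcd m s = 1),
        Complex.exp (2 * Real.pi * Complex.I *
          ((a : ℂ) * (((((m : ℤ) : ZMod s)⁻¹).val : ℕ) : ℂ) / (s : ℂ))) *
        Complex.exp (2 * Real.pi * Complex.I * (θ / (m : ℂ)))‖ ≤
      (((M₂ - M₁ : ℤ) : ℝ) / s * Int.gcd a s +
        (Nat.divisors s).card * Real.sqrt s * Real.sqrt (Int.gcd a s) * (1 + Real.log s)) *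
        (1 + 2 * Real.pi * |θ| / ((M₁ : ℝ) + 1)) := by
  -- the untwisted partial sums (appendix Lemma 1 with `q = 1`, `v = 0`)
  set B : ℝ := ((M₂ - M₁ : ℤ) : ℝ) / s * Int.gcd a s +
    (Nat.divisors s).card * Real.sqrt s * Real.sqrt (Int.gcd a s) * (1 + Real.log s) with hB
  have hs0 : (0 : ℝ) < s := by exact_mod_cast hs
  have hB0 : 0 ≤ B := by
    have : (0 : ℝ) ≤ ((M₂ - M₁ : ℤ) : ℝ) := by exact_mod_cast (sub_nonneg.mpr hM)
    have hlog : 0 ≤ 1 + Real.log s := by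
      have := Real.log_nonneg (show (1 : ℝ) ≤ s by exact_mod_cast hs); linarith
    positivity
  obtain ⟨K, hK⟩ : ∃ K : ℕ, M₂ = M₁ + K := ⟨(M₂ - M₁).toNat, by omega⟩
  subst hK
  rcases Nat.eq_zero_or_pos K with hK0 | hKpos
  · subst hK0
    simp only [Nat.cast_zero, add_zero, Finset.Ioc_self, Finset.filter_empty, Finset.sum_empty,
      norm_zero]
    have : 0 ≤ 1 + 2 * Real.pi * |θ| / ((M₁ : ℝ) + 1) := by
      have hM1 : (0 : ℝ) < (M₁ : ℝ) + 1 := by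
        have : (0 : ℝ) ≤ M₁ := by exact_mod_cast hM₁
        linarith
      positivity
    positivity
  have hpartial : ∀ k : ℕ, k ≤ K →
      ‖∑ n ∈ (Finset.Ioc M₁ (M₁ + k)).filter (fun m : ℤ => Int.gcd m s = 1),
        Complex.exp (2 * Real.pi * Complex.I *
          ((a : ℂ) * (((((n : ℤ) : ZMod s)⁻¹).val : ℕ) : ℂ) / (s : ℂ)))‖ ≤ B := by
    intro k hk
    have h := KI_sum_progression_le hs (q := 1) (Nat.coprime_one_left s) a 0 M₁ (M₁ + k)
      (by omega)
    simp only [Nat.cast_one, one_mul, zero_add] at h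
    refine h.trans ?_
    rw [hB]
    have hk' : (((M₁ + k - M₁ : ℤ)) : ℝ) ≤ ((M₁ + K - M₁ : ℤ) : ℝ) := by
      have : (k : ℝ) ≤ K := by exact_mod_cast hk
      push_cast; linarith
    have hg : (0 : ℝ) ≤ Int.gcd a s := Nat.cast_nonneg _
    have := div_le_div_of_nonneg_right hk' hs0.le
    nlinarith [mul_le_mul_of_nonneg_right this hg]
  have hf1 : ∀ n : ℤ, ‖Complex.exp (2 * Real.pi * Complex.I * (θ / (n : ℂ)))‖ ≤ 1 := by
    intro n
    have : 2 * (Real.pi : ℂ) * Complex.I * (θ / (n : ℂ)) = ((2 * Real.pi * (θ / n) : ℝ) : ℂ) * Complex.I := by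
      push_cast; ring
    rw [this, Complex.norm_exp_ofReal_mul_I]
  have hvar : ∀ n : ℤ, M₁ < n →
      ‖Complex.exp (2 * Real.pi * Complex.I * (θ / ((n + 1 : ℤ) : ℂ))) -
        Complex.exp (2 * Real.pi * Complex.I * (θ / (n : ℂ)))‖ ≤
        2 * Real.pi * |θ| / (n : ℝ) - 2 * Real.pi * |θ| / ((n + 1 : ℤ) : ℝ) := by
    intro n hn
    have hn0 : 0 < n := lt_of_le_of_lt hM₁ hn
    have h := kfw_twist_variation θ hn0
    refine h.trans (le_of_eq ?_)
    push_cast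
    ring
  have h := kfw_abel_bound M₁ hKpos (fun m : ℤ => Int.gcd m s = 1)
    (fun n : ℤ => Complex.exp (2 * Real.pi * Complex.I *
      ((a : ℂ) * (((((n : ℤ) : ZMod s)⁻¹).val : ℕ) : ℂ) / (s : ℂ))))
    (fun n : ℤ => Complex.exp (2 * Real.pi * Complex.I * (θ / (n : ℂ))))
    (fun n : ℤ => 2 * Real.pi * |θ| / (n : ℝ)) hB0 hpartial hf1
    (fun n hn => by simpa only [Int.cast_add, Int.cast_one] using hvar n hn)
  refine h.trans ?_
  refine mul_le_mul_of_nonneg_left ?_ hB0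
  have hM1 : (0 : ℝ) < (M₁ : ℝ) + 1 := by
    have : (0 : ℝ) ≤ M₁ := by exact_mod_cast hM₁
    linarith
  have hlast : 0 ≤ 2 * Real.pi * |θ| / (((M₁ + (K : ℕ) : ℤ)) : ℝ) := by
    have : (0 : ℝ) < ((M₁ + (K : ℕ) : ℤ) : ℝ) := by
      push_cast
      have : (0 : ℝ) ≤ M₁ := by exact_mod_cast hM₁
      have : (1 : ℝ) ≤ K := by exact_mod_cast hKpos
      linarith
    positivity
  have e1 : (((M₁ + 1 : ℤ)) : ℝ) = (M₁ : ℝ) + 1 := by push_cast; ring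
  rw [e1]
  linarith

end Literature.NumberTheory.LFunctions

end
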